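import Literature.NumberTheory.NumberFields.HilbertClassFieldArtinEquivariance
import Literature.NumberTheory.NumberFields.HilbertClassFieldOfGaloisExtension
import Literature.NumberTheory.NumberFields.InertiaGeneratesGalois
import HarnessLib

/-!
# The equivariant Iwasawa lemma, II: a Galois-isotypic component of the class group that is absent
# below a cyclic layer of prime degree, and absent from its ramification, is absent above
# (Washington §13.3 Lemma 13.15 / Thm. 10.4, equivariant form, by class field theory)

Topic `NumberTheory/NumberFields` (namespace = path, grouping sub-namespace `EquivariantIwasawaLemma`).
THEOREM-ONLY file (no definition, no named fact, no `sorry`), written by the literature seat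
`bsd-potss-conjA-anchor` g16 (cell `bsd-potss`; it serves stmt-BirchSwinnertonDyer-19386 / 19413 —
hypothesis (c2) of Deo–Ray–Sujatha's Thm. 3.8/3.9 at the LAYERS of the cyclotomic tower — and closes
nothing; neither Conjecture A nor BSD is proved for any curve here).

## Statement (`equivariantHom_classGroup_eq_zero_of_cyclic_layer`)

Let `k ⊆ B ⊆ F` be number fields with `F/k` Galois, `B/k` normal, `[F : B] = p` prime and `Gal(F/B)`
CENTRAL in `Gal(F/k)` (e.g. `F = Lℚ_{n+1} ⊇ B = Lℚ_n ⊇ k = ℚ` for `L/ℚ` Galois: `Gal(F/ℚ) = Gal(L/ℚ) × ℤ/p^{n+1}`).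
Let a group `Γ` act on an additive group `V` with `p • V = 0`, through a surjection `π : Γ → Gal(F/k)`
whose elements over `Gal(F/B)` act trivially (`V` is a `Gal(B/k)`-module; `Γ` may be `Gal(F/k)` itself or
the absolute Galois group of `k`).  Assume
* (c3*) for every prime `𝔓` of `F` ramified over `B`, a vector of `V` fixed by every `τ ∈ Γ` with
  `π(τ)𝔓 = 𝔓` is `0` («`V^{D_𝔭} = 0` for the ramified `𝔭 = 𝔓 ∩ B`»), and some ramified `𝔓₀` has a number of
  `Gal(F/k)`-conjugates prime to `p` (for `F = Lℚ_{n+1}`: the primes above `p`, `[Gal(L/ℚ) : D_p]` of them);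
* (c2*, Galois side at `B`) every function `χ : Gal(H_F/B) → V` (`H_F` the Hilbert class field of `F`,
  Galois over `k`) which is additive, kills the inertia group of every prime of `H_F`, and is
  `Γ`-equivariant for conjugation (`χ(g̃ g g̃⁻¹) = τ • χ(g)` when `g̃ ∈ Gal(H_F/k)` restricts to `π(τ)` on `F`)
  vanishes.  [`Gal(H_F/B)` modulo commutators and inertia is `Gal(H_B/B) ≅ Cl(B)` equivariantly, so this
  is `Hom_Γ(Cl(B), V) = 0`; that translation — Artin reciprocity for `B` — is the sequel file
  `EquivariantIwasawaLemmaClassGroup.lean`.]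
THEN every additive `f : Cl(F) → V` with `f(π(τ)·c) = τ • f(c)` (`Gal(F/k)` acting on ideal classes) is `0`.

With `V = E[p]`, `k = ℚ`, `B = L_n`, `F = L_{n+1}` (`L = ℚ(E[p])`, `p ∤ #Gal(L/ℚ)`) this is the induction
step of «door L6» of the cell's census: `Hom_G(Cl(L_n), E[p]) = 0` and `E(ℚ_p)[p] = 0` imply
`Hom_G(Cl(L_{n+1}), E[p]) = 0` (memo `run/shared/lean/pub/bsd-potss/conjA-anchor/g15/FINDING-…-g15.md` §9,
where it was derived from ISOTYPIC GENUS THEORY — Chevalley's formula and the Herbrand quotient of units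
read `ρ̄`-isotypically; the present road needs no units).  For `V` trivial it is Iwasawa's
«`p ∤ h_B`, one totally ramified prime `⟹ p ∤ h_F`» (Washington Thm. 10.4; tree
`ClassNumberPExtensionOnePrime.lean`).

## Proof (Washington §13.3, Lemmas 13.14–13.15, equivariantly; formalised below)

`E = H_F` is Galois over `k` (tree `hilbertClassField.isGalois_of_isGalois`); `G = Gal(E/B)`,
`r : G → Q = Gal(F/B)`, `A = ker r = Gal(E/F) ≅ Cl(F)` by the Artin isomorphism, which is EQUIVARIANT
(tree `hilbertClassField.artinEquiv_mulEquiv_intAut_apply`): `φ := f ∘ Artin⁻¹` on `A` is additive and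
`φ(g̃ a g̃⁻¹) = τ • φ(a)`, in particular invariant under `G`-conjugation (those `τ` act trivially).  Every
inertia group `I(𝔔) ≤ G` meets `A` trivially (`E/F` unramified) so `r` maps it injectively to `Q`; for a
ramified prime it is onto.  (i) For `𝔔, 𝔔′` over ramified primes and `s ∈ I(𝔔)`, `t ∈ I(𝔔′)` with
`r s = r t` one has `φ(s t⁻¹) = 0`: primes of `E` over one prime of `F` are `A`-conjugate, which changes `s`
by a commutator `⁅a, s⁆`, killed by `φ`; so `u(𝔓, 𝔓′) := φ(s_𝔓 s_{𝔓′}⁻¹)` is a well-defined additive cocycle on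
the ramified primes of `F`, `Γ`-equivariant because `g̃ I(𝔔) g̃⁻¹ = I(g̃𝔔)` and `r(g̃ s g̃⁻¹) = r(s)`
(centrality); averaging it over the conjugates of `𝔓₀` gives a vector fixed by the decomposition group,
zero by (c3*), whence `#orbit • u = 0` and `u = 0` (`p`-torsion, `#orbit` prime to `p`).  (ii) With a
ramified `𝔔₀` the inverse `sec : Q → I(𝔔₀)` of `r` is a homomorphic section and
`χ(g) := φ(g · sec(r g)⁻¹)` extends `φ` to `G`; it is additive (conjugation invariance), kills every
inertia group (by (i)) and is `Γ`-equivariant (by (i) again, `g̃ sec(q) g̃⁻¹ ∈ I(g̃𝔔₀)` having image `q`).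
By (c2*) `χ = 0`, so `φ = 0` and `f = 0`.  ∎  No unit group, norm index or Herbrand quotient enters.

The statement is not in print in this form (the printed isotypic statements — G. Gras, *Nombre de
φ-classes invariantes*, Bull. SMF 106 (1978); Proc. Math. Sci. 127 (2017) §5 — are genus-theoretic and
for abelian characters); the theorems below carry the citation of the printed argument they transcribe
(Washington §13.3) as the tree's lint requires, and this docstring records the difference.

## References

* L. C. Washington, *Introduction to Cyclotomic Fields*, 2nd ed., GTM 83 (1997), §13.3 Lemmas 13.14–13.15,
  Thm. 10.4. [Washington1997]
* J. Neukirch, *Algebraic Number Theory* (1999), Ch. VI (6.9), (7.1); Ch. IV §6 (equivariance of the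
  Artin symbol). [NeukirchANT1999]
* S. V. Deo, A. Ray, R. Sujatha, Pure Appl. Math. Q. 19 (2023), §3 Thm. 3.8 (c1)–(c3). [DeoRaySujatha2023]
-/

noncomputable section

open scoped Pointwise
open NumberField IsDedekindDomain Ideal

namespace Literature.NumberTheory.NumberFields

namespace EquivariantIwasawaLemma

open Literature.NumberTheory.NumberFields.hilbertClassField

/-! ### Private helpers: torsion, orbit averaging, conjugation transport -/

/-- An element of an additive group killed by two coprime natural numbers is zero. [folklore] -/
private theorem eq_zero_of_nsmul_eq_zero_of_coprime {M : Type*} [AddMonoid M] {a b : ℕ}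
    (hab : a.Coprime b) {x : M} (ha : a • x = 0) (hb : b • x = 0) : x = 0 := by
  have hord : addOrderOf x ∣ 1 := by
    rw [← hab]
    exact Nat.dvd_gcd (addOrderOf_dvd_of_nsmul_eq_zero ha) (addOrderOf_dvd_of_nsmul_eq_zero hb)
  exact AddMonoid.addOrderOf_eq_one_iff.mp (Nat.dvd_one.mp hord)

/-- ORBIT AVERAGING.  `Γ` acts on `V` and, through `π : Γ →* G₀`, on `Y`; `u : Y → Y → V` is an additive
cocycle on `S ⊆ Y` (`u x y + u y z = u x z`), equivariant (`u (γx) (γy) = γ • u x y`); every vector fixed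
by the stabiliser of a point of `S` is `0`; `V` is `p`-torsion and a finite `G₀`-stable `O ⊆ S` has
cardinality prime to `p`.  Then `u ≡ 0` on `S` (`w x = Σ_{z ∈ O} u x z` is equivariant, so `0`, and
`w x - w y = #O • u x y`). [folklore] -/
private theorem cocycle_eq_zero_of_coprime_card {Γ G₀ Y V : Type*} [Group Γ] [Group G₀]
    [MulAction G₀ Y] [AddCommGroup V] [DistribMulAction Γ V] (π : Γ →* G₀) {p : ℕ}
    (hpV : ∀ v : V, p • v = 0) (S : Set Y) (O : Finset Y) (hOS : ∀ z ∈ O, z ∈ S)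
    (hO : ∀ g : G₀, ∀ z ∈ O, g • z ∈ O) (hcop : O.card.Coprime p) (u : Y → Y → V)
    (hcoc : ∀ x ∈ S, ∀ y ∈ S, ∀ z ∈ S, u x y + u y z = u x z)
    (hequiv : ∀ (τ : Γ), ∀ x ∈ S, ∀ y ∈ S, u (π τ • x) (π τ • y) = τ • u x y)
    (hfix : ∀ x ∈ S, ∀ v : V, (∀ τ : Γ, π τ • x = x → τ • v = v) → v = 0)
    {x y : Y} (hx : x ∈ S) (hy : y ∈ S) : u x y = 0 := by
  classical
  let w : Y → V := fun x => ∑ z ∈ O, u x z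
  have hw : ∀ (τ : Γ), ∀ x ∈ S, τ • w x = w (π τ • x) := by
    intro τ x hx
    simp only [w, Finset.smul_sum]
    rw [show ∑ z ∈ O, τ • u x z = ∑ z ∈ O, u (π τ • x) (π τ • z) from
      Finset.sum_congr rfl fun z hz => (hequiv τ x hx z (hOS z hz)).symm]
    exact Finset.sum_bij' (fun z _ => π τ • z) (fun z _ => (π τ)⁻¹ • z)
      (fun z hz => hO _ z hz) (fun z hz => hO _ z hz) (fun z _ => inv_smul_smul _ z)
      (fun z _ => smul_inv_smul _ z) (fun z _ => rfl)
  have hw0 : ∀ x ∈ S, w x = 0 := by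
    intro x hx
    refine hfix x hx (w x) fun τ hτ => ?_
    rw [hw τ x hx, hτ]
  have hsum : O.card • u x y = w x - w y := by
    simp only [w, ← Finset.sum_sub_distrib]
    rw [Finset.card_eq_sum_ones, Finset.sum_smul]
    refine Finset.sum_congr rfl fun z hz => ?_
    rw [one_smul, ← hcoc x hx y hy z (hOS z hz), add_sub_cancel_right]
  rw [hw0 x hx, hw0 y hy, sub_zero] at hsum
  exact eq_zero_of_nsmul_eq_zero_of_coprime hcop hsum (hpV _)

section Conj

variable {k B E : Type*} [Field k] [Field B] [Field E] [Algebra k B] [Algebra k E] [Algebra B E]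
  [IsScalarTower k B E] [Normal k B]

/-- `g̃⁻¹` moves `B` by `(g̃|_B)⁻¹`. [folklore] -/
private theorem symm_algebraMap (g : E ≃ₐ[k] E) (x : B) :
    g.symm (algebraMap B E x) = algebraMap B E ((g.restrictNormal B).symm x) := by
  apply g.injective
  rw [AlgEquiv.apply_symm_apply, ← AlgEquiv.restrictNormal_commutes, AlgEquiv.apply_symm_apply]

/-- **Conjugation transport.**  For `g̃ ∈ Aut(E/k)` and `σ ∈ Aut(E/B)` (`B/k` normal) the conjugate
`g̃ σ g̃⁻¹` is again `B`-linear. [folklore] -/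
private theorem exists_conj (g : E ≃ₐ[k] E) (σ : E ≃ₐ[B] E) :
    ∃ σ' : E ≃ₐ[B] E, ∀ y, σ' y = g (σ (g.symm y)) := by
  refine ⟨AlgEquiv.ofRingEquiv (f := g.symm.toRingEquiv.trans (σ.toRingEquiv.trans g.toRingEquiv))
    fun x => ?_, fun y => rfl⟩
  change g (σ (g.symm (algebraMap B E x))) = algebraMap B E x
  rw [symm_algebraMap, AlgEquiv.commutes, ← AlgEquiv.restrictNormal_commutes, AlgEquiv.apply_symm_apply]

omit [Algebra k B] [IsScalarTower k B E] [Normal k B] in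
/-- The conjugate of a product is the product of the conjugates (pointwise description). [folklore] -/
private theorem conj_mul_inv (g : E ≃ₐ[k] E) {σ τ σ' τ' : E ≃ₐ[B] E}
    (hσ : ∀ y, σ' y = g (σ (g.symm y))) (hτ : ∀ y, τ' y = g (τ (g.symm y))) (y : E) :
    (σ' * τ'⁻¹) y = g ((σ * τ⁻¹) (g.symm y)) := by
  -- `τ'⁻¹ y = g (τ⁻¹ (g⁻¹ y))`
  have h2 : τ'⁻¹ y = g (τ⁻¹ (g.symm y)) := by
    rw [AlgEquiv.aut_inv, AlgEquiv.aut_inv]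
    apply τ'.injective
    rw [AlgEquiv.apply_symm_apply, hτ, AlgEquiv.symm_apply_apply, AlgEquiv.apply_symm_apply,
      AlgEquiv.apply_symm_apply]
  rw [AlgEquiv.mul_apply, AlgEquiv.mul_apply, hσ, h2, AlgEquiv.symm_apply_apply]

variable [NumberField E]

omit [Algebra k B] [IsScalarTower k B E] [Normal k B] [NumberField E] in
/-- Conjugation transports inertia groups: if `s ∈ I(𝔔)` (inertia in `Aut(E/B)`) and `s' = g̃ s g̃⁻¹`
then `s' ∈ I(g̃ • 𝔔)`. [folklore] -/
private theorem conj_mem_inertia (g : E ≃ₐ[k] E) {s s' : E ≃ₐ[B] E} (hs' : ∀ y, s' y = g (s (g.symm y)))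
    {Q : Ideal (𝓞 E)} (hs : s ∈ Q.inertia (E ≃ₐ[B] E)) : s' ∈ (g • Q).inertia (E ≃ₐ[B] E) := by
  simp only [AddSubgroup.mem_inertia, Submodule.mem_toAddSubgroup] at hs ⊢
  intro x
  rw [Ideal.mem_pointwise_smul_iff_inv_smul_mem, smul_sub]
  have h1 : g⁻¹ • (s' • x) = s • (g⁻¹ • x) := by
    apply Subtype.ext
    change g.symm (s' (x : E)) = s (g.symm (x : E))
    rw [hs', AlgEquiv.symm_apply_apply]
  rw [h1]
  exact hs (g⁻¹ • x)

/-- The conjugate `g̃ • 𝔔` of a maximal ideal of `𝓞_E` is maximal. [folklore] -/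
private theorem smul_isMaximal (g : E ≃ₐ[k] E) (Q : Ideal (𝓞 E)) [hQ : Q.IsMaximal] :
    (g • Q).IsMaximal := by
  refine Ideal.IsPrime.isMaximal inferInstance fun h => ?_
  apply Ideal.IsMaximal.ne_bot_of_isIntegral_int Q
  have h2 : g⁻¹ • g • Q = g⁻¹ • (⊥ : Ideal (𝓞 E)) := by rw [h]
  rwa [inv_smul_smul, Ideal.smul_bot] at h2

end Conj

/-- A `B`-linear automorphism restricted to scalars `k` acts on `𝓞 E` and its ideals in the same way.
[folklore] -/
private theorem restrictScalars_smul_ideal {k B E : Type*} [Field k] [Field B] [Field E] [NumberField E]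
    [Algebra k B] [Algebra k E] [Algebra B E] [IsScalarTower k B E] (σ : E ≃ₐ[B] E) (Q : Ideal (𝓞 E)) :
    (σ.restrictScalars k) • Q = σ • Q := by
  have h : (MulSemiringAction.toRingHom (E ≃ₐ[k] E) (𝓞 E) (σ.restrictScalars k)) =
      MulSemiringAction.toRingHom (E ≃ₐ[B] E) (𝓞 E) σ := RingHom.ext fun _ => rfl
  change Q.map _ = Q.map _
  rw [h]

/-- `(g̃ • 𝔔) ∩ 𝓞_F = g̃|_F • (𝔔 ∩ 𝓞_F)` for `g̃ ∈ Aut(E/k)` and `F/k` normal inside `E`. [folklore] -/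
private theorem under_smul {k F E : Type*} [Field k] [Field F] [NumberField F] [Field E] [NumberField E]
    [Algebra k F] [Algebra k E] [Algebra F E] [IsScalarTower k F E] [Normal k F]
    (g : E ≃ₐ[k] E) (Q : Ideal (𝓞 E)) :
    (g • Q).under (𝓞 F) = (g.restrictNormal F) • Q.under (𝓞 F) := by
  ext x
  rw [Ideal.under_def, Ideal.mem_comap, Ideal.mem_pointwise_smul_iff_inv_smul_mem,
    Ideal.mem_pointwise_smul_iff_inv_smul_mem, Ideal.under_def, Ideal.mem_comap]
  have h : g⁻¹ • algebraMap (𝓞 F) (𝓞 E) x = algebraMap (𝓞 F) (𝓞 E) ((g.restrictNormal F)⁻¹ • x) := by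
    apply Subtype.ext
    change g.symm (algebraMap F E (x : F)) = algebraMap F E ((g.restrictNormal F).symm (x : F))
    exact symm_algebraMap g (x : F)
  rw [h]

/-! ### The theorem -/

section Main

variable {k B F : Type} [Field k] [Field B] [NumberField B] [Field F] [NumberField F]
  [Algebra k B] [Algebra k F] [Algebra B F] [IsScalarTower k B F] [IsGalois k F] [Normal k B]

/-- **The equivariant Iwasawa lemma (Galois-side base hypothesis).**  `k ⊆ B ⊆ F` number fields, `F/k`
Galois, `B/k` normal, `[F : B] = p` prime, `Gal(F/B)` central in `Gal(F/k)`; `Γ` acts on the `p`-torsion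
additive group `V` through the surjection `π : Γ →* Gal(F/k)`, elements over `Gal(F/B)` acting trivially.
IF (c3*) for every prime `𝔓` of `F` ramified over `B` the vectors fixed by `{τ : π(τ)𝔓 = 𝔓}` are `0`, some
ramified prime has a number of `Gal(F/k)`-conjugates prime to `p`, and (c2*) every additive
`χ : Gal(H_F/B) → V` killing all inertia groups and `Γ`-equivariant under conjugation vanishes
(`H_F = hilbertClassField F`; this is `Hom_Γ(Cl(B), V) = 0` read through Artin reciprocity for `B`, see the
sequel file), THEN every `Γ`-equivariant additive `f : Cl(𝓞_F) → V` is zero.  Washington's Lemma 13.15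
(`X ∩ ⟨G', I_𝔔⟩`, `X = Gal(H_F/F)`) made equivariant; proof in the module docstring.
[cite: Washington1997, §13.3 Lemmas 13.14–13.15 and Thm. 10.4 (proof)]
[cite: NeukirchANT1999, Ch. VI (6.9) and Ch. IV §6 (equivariance of the Artin symbol)] -/
theorem equivariantHom_classGroup_eq_zero_of_cyclic_layer (p : ℕ) [hp : Fact p.Prime]
    (hdeg : Module.finrank B F = p)
    (hcent : ∀ (σ : F ≃ₐ[B] F) (τ : F ≃ₐ[k] F) (x : F), τ (σ x) = σ (τ x))
    {Γ : Type*} [Group Γ] (π : Γ →* (F ≃ₐ[k] F)) (hπ : Function.Surjective π)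
    {V : Type*} [AddCommGroup V] [DistribMulAction Γ V] (hpV : ∀ v : V, p • v = 0)
    (hV : ∀ τ : Γ, (∀ x : B, π τ (algebraMap B F x) = algebraMap B F x) → ∀ v : V, τ • v = v)
    (hD : ∀ (𝔓 : Ideal (𝓞 F)) [𝔓.IsMaximal], 𝔓.ramificationIdx (𝓞 B) ≠ 1 →
      ∀ v : V, (∀ τ : Γ, π τ • 𝔓 = 𝔓 → τ • v = v) → v = 0)
    (horb : ∃ (𝔓₀ : Ideal (𝓞 F)) (_ : 𝔓₀.IsMaximal), 𝔓₀.ramificationIdx (𝓞 B) ≠ 1 ∧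
      ¬ p ∣ (MulAction.stabilizer (F ≃ₐ[k] F) 𝔓₀).index)
    (h0 : ∀ χ : (hilbertClassField F ≃ₐ[B] hilbertClassField F) → V,
      (∀ a b, χ (a * b) = χ a + χ b) →
      (∀ (Q : Ideal (𝓞 (hilbertClassField F))) [Q.IsMaximal],
        ∀ s ∈ Q.inertia (hilbertClassField F ≃ₐ[B] hilbertClassField F), χ s = 0) →
      (∀ (τ : Γ) (g : hilbertClassField F ≃ₐ[k] hilbertClassField F)
        (a a' : hilbertClassField F ≃ₐ[B] hilbertClassField F),
        AlgEquiv.restrictNormalHom F g = π τ → (∀ y, a' y = g (a (g.symm y))) → χ a' = τ • χ a) →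
      ∀ a, χ a = 0)
    (f : Additive (ClassGroup (𝓞 F)) →+ V)
    (hf : ∀ (τ : Γ) (c : ClassGroup (𝓞 F)),
      f (Additive.ofMul (ClassGroup.mulEquiv (AmbiguousClass.intAut (π τ)) c)) = τ • f (Additive.ofMul c)) :
    f = 0 := by
  classical
  -- ### Galois setup: `E = H_F`, `GB = Gal(E/B)`, `r : GB → Gal(F/B)`, `A = ker r ≅ Gal(E/F)`
  haveI : CharZero k := (algebraMap k F).charZero
  haveI : FiniteDimensional k F := Module.Finite.of_restrictScalars_finite ℚ k F
  haveI : IsGalois B F := IsGalois.tower_top_of_isGalois k B F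
  haveI : IsScalarTower k F (hilbertClassField F) :=
    IsScalarTower.of_algebraMap_eq fun x => Subtype.ext (IsScalarTower.algebraMap_apply k F _ x)
  haveI : IsScalarTower B F (hilbertClassField F) :=
    IsScalarTower.of_algebraMap_eq fun x => Subtype.ext (IsScalarTower.algebraMap_apply B F _ x)
  haveI : IsScalarTower k B (hilbertClassField F) := IsScalarTower.of_algebraMap_eq fun x => by
    rw [IsScalarTower.algebraMap_apply B F (hilbertClassField F),
      ← IsScalarTower.algebraMap_apply k B F, ← IsScalarTower.algebraMap_apply k F (hilbertClassField F)]
  haveI : IsGalois k (hilbertClassField F) := hilbertClassField.isGalois_of_isGalois F (K := k)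
  haveI : IsGalois B (hilbertClassField F) := hilbertClassField.isGalois_of_isGalois F (K := B)
  haveI : FiniteDimensional B (hilbertClassField F) := Module.Finite.trans F (hilbertClassField F)
  have hp0 : 0 < p := hp.out.pos
  -- restriction maps
  obtain ⟨r, hr⟩ : ∃ r : (hilbertClassField F ≃ₐ[B] hilbertClassField F) →* (F ≃ₐ[B] F),
      r = AlgEquiv.restrictNormalHom F := ⟨_, rfl⟩
  obtain ⟨rk, hrk⟩ : ∃ rk : (hilbertClassField F ≃ₐ[k] hilbertClassField F) →* (F ≃ₐ[k] F),
      rk = AlgEquiv.restrictNormalHom F := ⟨_, rfl⟩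
  have hr_apply : ∀ g x, algebraMap F (hilbertClassField F) (r g x) = g (algebraMap F _ x) := by
    intro g x; rw [hr]; exact AlgEquiv.restrictNormal_commutes g F x
  have hrk_apply : ∀ g x, algebraMap F (hilbertClassField F) (rk g x) = g (algebraMap F _ x) := by
    intro g x; rw [hrk]; exact AlgEquiv.restrictNormal_commutes g F x
  have hrk_eq : ∀ g, rk g = g.restrictNormal F := fun g => by rw [hrk]; rfl
  have hrk_surj : Function.Surjective rk := by
    rw [hrk]; exact AlgEquiv.restrictNormalHom_surjective (hilbertClassField F)
  have hcardQ : Nat.card (F ≃ₐ[B] F) = p := by rw [IsGalois.card_aut_eq_finrank, hdeg]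
  have hQprime : (Nat.card (F ≃ₐ[B] F)).Prime := by rw [hcardQ]; exact hp.out
  -- `A = Gal(E/F)` inside `GB`
  let ρ : (hilbertClassField F ≃ₐ[F] hilbertClassField F) →* (hilbertClassField F ≃ₐ[B] hilbertClassField F) :=
    { toFun := fun σ => σ.restrictScalars B
      map_one' := rfl
      map_mul' := fun _ _ => rfl }
  have hρ_inj : Function.Injective ρ := fun σ τ h => AlgEquiv.restrictScalars_injective B h
  have hρ_apply : ∀ σ y, ρ σ y = σ y := fun _ _ => rfl
  have hmem_ker : ∀ g, r g = 1 ↔ ∀ x : F, g (algebraMap F _ x) = algebraMap F _ x := by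
    intro g
    constructor
    · intro h x
      rw [← hr_apply, h, AlgEquiv.one_apply]
    · intro h
      apply AlgEquiv.ext
      intro x
      apply (algebraMap F (hilbertClassField F)).injective
      rw [hr_apply, h, AlgEquiv.one_apply]
  have hρ_ker : ∀ σ, r (ρ σ) = 1 := fun σ => (hmem_ker _).mpr fun x => σ.commutes x
  have hρ_surj : ∀ g, r g = 1 → ∃ σ, ρ σ = g := fun g hg =>
    ⟨{ g with commutes' := fun x => (hmem_ker g).mp hg x }, AlgEquiv.ext fun _ => rfl⟩
  -- a two-sided inverse `ι` of `ρ` on `ker r`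
  obtain ⟨ι, hι⟩ : ∃ ι : (hilbertClassField F ≃ₐ[B] hilbertClassField F) →
      (hilbertClassField F ≃ₐ[F] hilbertClassField F), ∀ g, r g = 1 → ρ (ι g) = g := by
    refine ⟨fun g => if hg : r g = 1 then (hρ_surj g hg).choose else 1, fun g hg => ?_⟩
    simp only [hg, dite_true]
    exact (hρ_surj g hg).choose_spec
  have hιρ : ∀ σ, ι (ρ σ) = σ := fun σ => hρ_inj (hι _ (hρ_ker σ))
  -- ### the functional `φ = f ∘ Artin⁻¹` on `ker r`
  let φ : (hilbertClassField F ≃ₐ[B] hilbertClassField F) → V :=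
    fun g => f (Additive.ofMul ((artinEquiv F).symm (ι g)))
  have hφρ : ∀ c : ClassGroup (𝓞 F), φ (ρ (artinEquiv F c)) = f (Additive.ofMul c) := by
    intro c; simp only [φ, hιρ, MulEquiv.symm_apply_apply]
  have hadd : ∀ a b, r a = 1 → r b = 1 → φ (a * b) = φ a + φ b := by
    intro a b ha hb
    have h : ι (a * b) = ι a * ι b := hρ_inj (by rw [map_mul, hι _ ha, hι _ hb, hι _ (by rw [map_mul, ha, hb, one_mul])])
    simp only [φ, h, map_mul, ofMul_mul, map_add]
  have hφ1 : φ 1 = 0 := by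
    have h := hadd 1 1 (map_one r) (map_one r)
    rw [mul_one] at h
    exact left_eq_add.mp h
  have hinv : ∀ a, r a = 1 → φ a⁻¹ = -φ a := by
    intro a ha
    have h := hadd a a⁻¹ ha (by rw [map_inv, ha, inv_one])
    rw [mul_inv_cancel, hφ1] at h
    exact (neg_eq_of_add_eq_zero_right h.symm).symm
  -- EQUIVARIANCE of `φ` (Artin reciprocity is equivariant)
  have hφequiv : ∀ (τ : Γ) (g : hilbertClassField F ≃ₐ[k] hilbertClassField F)
      (a a' : hilbertClassField F ≃ₐ[B] hilbertClassField F),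
      rk g = π τ → (∀ y, a' y = g (a (g.symm y))) → r a = 1 → φ a' = τ • φ a := by
    intro τ g a a' hg ha' ha
    -- `a'` also lies in `ker r`
    have ha'1 : r a' = 1 := by
      rw [hmem_ker]
      intro x
      rw [ha', symm_algebraMap g x, (hmem_ker a).mp ha, ← symm_algebraMap g x, AlgEquiv.apply_symm_apply]
    set c : ClassGroup (𝓞 F) := (artinEquiv F).symm (ι a) with hc
    have hca : ρ (artinEquiv F c) = a := by rw [hc, MulEquiv.apply_symm_apply, hι _ ha]
    -- the Artin image of `π τ • c` is `g ∘ artin(c) ∘ g⁻¹ = a'`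
    have hτg : ∀ x : F, g (algebraMap F (hilbertClassField F) x) =
        algebraMap F (hilbertClassField F) (π τ x) := by
      intro x; rw [← hrk_apply, hg]
    have key : ρ (artinEquiv F (ClassGroup.mulEquiv (AmbiguousClass.intAut (π τ)) c)) = a' := by
      apply AlgEquiv.ext
      intro y
      rw [hρ_apply, artinEquiv_mulEquiv_intAut_apply F g (π τ) hτg c y, ha', ← hρ_apply (artinEquiv F c),
        hca]
    have key' : ι a' = artinEquiv F (ClassGroup.mulEquiv (AmbiguousClass.intAut (π τ)) c) :=
      hρ_inj (by rw [hι _ ha'1, key])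
    change f (Additive.ofMul ((artinEquiv F).symm (ι a'))) = τ • f (Additive.ofMul c)
    rw [key', MulEquiv.symm_apply_apply, hf]
  -- conjugation INVARIANCE under `GB` (those `τ` act trivially on `V`)
  have hconj : ∀ g a, r a = 1 → φ (g * a * g⁻¹) = φ a := by
    intro g a ha
    obtain ⟨τ, hτ⟩ := hπ (rk (g.restrictScalars k))
    have h := hφequiv τ (g.restrictScalars k) a (g * a * g⁻¹) hτ.symm (fun y => rfl) ha
    rw [h]
    refine hV τ (fun x => ?_) _
    apply (algebraMap F (hilbertClassField F)).injective
    rw [hτ, hrk_apply, AlgEquiv.restrictScalars_apply,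
      ← IsScalarTower.algebraMap_apply B F (hilbertClassField F) x]
    exact g.commutes x
  -- ### inertia groups: `I(𝔔) ⊓ ker r = 1` (`E/F` unramified), `#I(𝔔) = e(𝔔 ∩ F | B)`
  have heE : ∀ (Q : Ideal (𝓞 (hilbertClassField F))) [Q.IsMaximal], Q.ramificationIdx (𝓞 F) = 1 := by
    intro Q _
    haveI := hilbertClassField.isUnramifiedAt F Q
    exact Ideal.ramificationIdx_eq_one Q (𝓞 F)
  have hI1 : ∀ (Q : Ideal (𝓞 (hilbertClassField F))) [Q.IsMaximal],
      ∀ s ∈ Q.inertia (hilbertClassField F ≃ₐ[B] hilbertClassField F), r s = 1 → s = 1 := by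
    intro Q _ s hs hrs
    obtain ⟨σ, rfl⟩ := hρ_surj s hrs
    have hσ : σ ∈ Q.inertia (hilbertClassField F ≃ₐ[F] hilbertClassField F) := fun x => hs x
    have hbot : Q.inertia (hilbertClassField F ≃ₐ[F] hilbertClassField F) = ⊥ := by
      rw [← Subgroup.card_eq_one, card_inertia_eq_ramificationIdx (hilbertClassField F)
        (hilbertClassField F ≃ₐ[F] hilbertClassField F) F Q, heE Q]
    rw [hbot, Subgroup.mem_bot] at hσ
    rw [hσ, map_one]
  have hcardI : ∀ (Q : Ideal (𝓞 (hilbertClassField F))) [Q.IsMaximal],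
      Nat.card (Q.inertia (hilbertClassField F ≃ₐ[B] hilbertClassField F)) =
        (Q.under (𝓞 F)).ramificationIdx (𝓞 B) := by
    intro Q _
    haveI : (Q.under (𝓞 F)).IsMaximal := Ideal.IsMaximal.under (𝓞 F) Q
    have h := Ideal.ramificationIdx_tower (R := 𝓞 B) (Q.under (𝓞 F)) Q
    rw [heE Q, mul_one] at h
    rw [card_inertia_eq_ramificationIdx (hilbertClassField F) (hilbertClassField F ≃ₐ[B] hilbertClassField F) B Q, h]
  -- `r` restricted to a non-trivial inertia group is a bijection onto `Gal(F/B)`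
  have hIsurj : ∀ (Q : Ideal (𝓞 (hilbertClassField F))) [Q.IsMaximal],
      (Q.under (𝓞 F)).ramificationIdx (𝓞 B) ≠ 1 →
        ∀ q : F ≃ₐ[B] F, ∃ s ∈ Q.inertia (hilbertClassField F ≃ₐ[B] hilbertClassField F), r s = q := by
    intro Q _ hne q
    -- the image of `I(𝔔)` is a subgroup of the prime-order group `Gal(F/B)`, non-trivial, hence everything
    have himg : (Q.inertia (hilbertClassField F ≃ₐ[B] hilbertClassField F)).map r = ⊤ := by
      haveI : Fact (Nat.card (F ≃ₐ[B] F)).Prime := ⟨hQprime⟩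
      rcases (Subgroup.map r (Q.inertia _)).eq_bot_or_eq_top_of_prime_card with h | h
      · exfalso
        apply hne
        rw [← hcardI Q, Subgroup.card_eq_one]
        rw [eq_bot_iff]
        intro s hs
        have : r s ∈ (Q.inertia (hilbertClassField F ≃ₐ[B] hilbertClassField F)).map r := ⟨s, hs, rfl⟩
        rw [h, Subgroup.mem_bot] at this
        exact hI1 Q s hs this
      · exact h
    have hq : q ∈ (Q.inertia (hilbertClassField F ≃ₐ[B] hilbertClassField F)).map r := by
      rw [himg]; exact Subgroup.mem_top q
    obtain ⟨s, hs, rfl⟩ := hq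
    exact ⟨s, hs, rfl⟩
  have hIuniq : ∀ (Q : Ideal (𝓞 (hilbertClassField F))) [Q.IsMaximal],
      ∀ s ∈ Q.inertia (hilbertClassField F ≃ₐ[B] hilbertClassField F),
      ∀ t ∈ Q.inertia (hilbertClassField F ≃ₐ[B] hilbertClassField F), r s = r t → s = t := by
    intro Q _ s hs t ht h
    have h1 : s * t⁻¹ = 1 := hI1 Q _ (mul_mem hs (inv_mem ht)) (by rw [map_mul, map_inv, h, mul_inv_cancel])
    rw [← mul_inv_eq_one, h1]
  -- centrality: conjugation by `Gal(E/k)` does not change the image under `r`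
  have hr_conj : ∀ (g : hilbertClassField F ≃ₐ[k] hilbertClassField F)
      (a a' : hilbertClassField F ≃ₐ[B] hilbertClassField F), (∀ y, a' y = g (a (g.symm y))) → r a' = r a := by
    intro g a a' ha'
    apply AlgEquiv.ext
    intro x
    apply (algebraMap F (hilbertClassField F)).injective
    rw [hr_apply, ha', symm_algebraMap g x, ← hrk_eq g, ← hr_apply, ← hrk_apply, hcent,
      AlgEquiv.apply_symm_apply]
  -- ### (i) the inertia-difference cocycle on the ramified primes of `F` vanishes
  -- the set of ramified primes of `F`
  obtain ⟨S, hS⟩ : ∃ S : Set (Ideal (𝓞 F)), S = {P | P.IsMaximal ∧ P.ramificationIdx (𝓞 B) ≠ 1} := ⟨_, rfl⟩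
  -- a prime of `E` over each prime of `F`
  have hexQ : ∀ P : Ideal (𝓞 F), P.IsMaximal → ∃ (Q : Ideal (𝓞 (hilbertClassField F))), Q.IsMaximal ∧
      Q.under (𝓞 F) = P := by
    intro P hP
    obtain ⟨Q, hQmax, hQP⟩ := Ideal.exists_maximal_ideal_liesOver_of_isIntegral (S := 𝓞 (hilbertClassField F)) P
    exact ⟨Q, hQmax, hQP.over.symm⟩
  -- `S` is `Gal(F/k)`-stable
  have hSsmul : ∀ (σ : F ≃ₐ[k] F), ∀ P ∈ S, σ • P ∈ S := by
    intro σ P hP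
    rw [hS] at hP ⊢
    obtain ⟨hPmax, hPe⟩ := hP
    obtain ⟨g, hg⟩ := hrk_surj σ
    obtain ⟨Q, hQmax, hQP⟩ := hexQ P hPmax
    haveI := hQmax
    haveI : (g • Q).IsMaximal := smul_isMaximal g Q
    haveI : ((g • Q).under (𝓞 F)).IsMaximal := Ideal.IsMaximal.under (𝓞 F) (g • Q)
    have hunder : (g • Q).under (𝓞 F) = σ • P := by rw [under_smul, ← hrk_eq, hg, ← hQP]
    refine ⟨hunder ▸ inferInstance, ?_⟩
    rw [← hunder, ← hcardI (g • Q)]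
    rw [← hQP, ← hcardI Q, ne_eq, Subgroup.card_eq_one, ← ne_eq, ← Subgroup.nontrivial_iff_ne_bot] at hPe
    rw [ne_eq, Subgroup.card_eq_one, ← ne_eq, ← Subgroup.nontrivial_iff_ne_bot]
    obtain ⟨⟨s, hs⟩, ⟨t, ht⟩, hst⟩ := hPe
    obtain ⟨s', hs'⟩ := exists_conj g s
    obtain ⟨t', ht'⟩ := exists_conj g t
    refine ⟨⟨s', conj_mem_inertia g hs' hs⟩, ⟨t', conj_mem_inertia g ht' ht⟩, fun h => hst ?_⟩
    have hst' : s' = t' := congrArg Subtype.val h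
    apply Subtype.ext
    apply AlgEquiv.ext
    intro z
    have h' := hs' (g z)
    rw [hst', ht', AlgEquiv.symm_apply_apply] at h'
    exact g.injective h'.symm
  -- now fix `q ≠ 1` and prove `φ (s t⁻¹) = 0` for inertia elements over `q`
  have hdiff : ∀ (Q : Ideal (𝓞 (hilbertClassField F))) [Q.IsMaximal]
      (Q' : Ideal (𝓞 (hilbertClassField F))) [Q'.IsMaximal],
      ∀ s ∈ Q.inertia (hilbertClassField F ≃ₐ[B] hilbertClassField F),
      ∀ t ∈ Q'.inertia (hilbertClassField F ≃ₐ[B] hilbertClassField F), r s = r t → φ (s * t⁻¹) = 0 := by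
    intro Q _ Q' _ s hs t ht hst
    by_cases hq1 : r s = 1
    · rw [hI1 Q s hs hq1, hI1 Q' t ht (hst ▸ hq1), inv_one, mul_one, hφ1]
    obtain ⟨q, hq⟩ : ∃ q, r s = q := ⟨_, rfl⟩
    -- canonical inertia elements over `q`: for `P ∈ S` choose `𝔔_P` over `P` and `s_P ∈ I(𝔔_P)` with `r s_P = q`
    have hchoice : ∀ P : Ideal (𝓞 F), ∃ (QP : Ideal (𝓞 (hilbertClassField F)))
        (sP : hilbertClassField F ≃ₐ[B] hilbertClassField F), P ∈ S →
        QP.IsMaximal ∧ QP.under (𝓞 F) = P ∧ sP ∈ QP.inertia (hilbertClassField F ≃ₐ[B] hilbertClassField F) ∧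
          r sP = q := by
      intro P
      by_cases hP : P ∈ S
      · have hP' := hP
        rw [hS] at hP'
        obtain ⟨QP, hQPmax, hQP⟩ := hexQ P hP'.1
        haveI := hQPmax
        obtain ⟨sP, hsP, hrsP⟩ := hIsurj QP (hQP.symm ▸ hP'.2) q
        exact ⟨QP, sP, fun _ => ⟨hQPmax, hQP, hsP, hrsP⟩⟩
      · exact ⟨⊤, 1, fun h => absurd h hP⟩
    choose cQ cs hc using hchoice
    -- well-definedness: any inertia element over `P ∈ S` with image `q` is `φ`-equivalent to `cs P`
    have hwd : ∀ P ∈ S, ∀ (Q₁ : Ideal (𝓞 (hilbertClassField F))) [Q₁.IsMaximal], Q₁.under (𝓞 F) = P →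
        ∀ s₁ ∈ Q₁.inertia (hilbertClassField F ≃ₐ[B] hilbertClassField F), r s₁ = q →
        φ (s₁ * (cs P)⁻¹) = 0 := by
      intro P hP Q₁ _ hQ₁ s₁ hs₁ hrs₁
      obtain ⟨hcQmax, hcQ, hcs, hrcs⟩ := hc P hP
      haveI := hcQmax
      haveI : P.IsMaximal := by rw [hS] at hP; exact hP.1
      haveI : Q₁.LiesOver P := ⟨hQ₁.symm⟩
      haveI : (cQ P).LiesOver P := ⟨hcQ.symm⟩
      -- the two primes over `P` are conjugate under `Gal(E/F)`
      obtain ⟨σ, hσ⟩ := Ideal.exists_smul_eq_of_isGaloisGroup P (cQ P) Q₁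
        (hilbertClassField F ≃ₐ[F] hilbertClassField F)
      have hσ' : ρ σ • cQ P = Q₁ := by
        rw [← hσ]; exact restrictScalars_smul_ideal σ (cQ P)
      -- `s₁ = (ρ σ) (cs P) (ρ σ)⁻¹`
      rw [← hσ', inertia_smul_eq_map_conj] at hs₁
      obtain ⟨s₀, hs₀, hs₀'⟩ := Subgroup.mem_map.mp hs₁
      have hs₀eq : s₀ = cs P := by
        refine hIuniq (cQ P) s₀ hs₀ (cs P) hcs ?_
        rw [hrcs, ← hrs₁, ← hs₀']
        change r s₀ = r (ρ σ * s₀ * (ρ σ)⁻¹)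
        rw [map_mul, map_mul, map_inv, hρ_ker, one_mul, inv_one, mul_one]
      rw [← hs₀', hs₀eq]
      change φ (ρ σ * cs P * (ρ σ)⁻¹ * (cs P)⁻¹) = 0
      -- `= φ (ρ σ) + φ (cs P (ρ σ)⁻¹ (cs P)⁻¹) = φ (ρ σ) - φ (ρ σ)`
      have h1 : ρ σ * cs P * (ρ σ)⁻¹ * (cs P)⁻¹ = ρ σ * (cs P * (ρ σ)⁻¹ * (cs P)⁻¹) := by group
      have h2 : r (cs P * (ρ σ)⁻¹ * (cs P)⁻¹) = 1 := by
        rw [map_mul, map_mul, map_inv, map_inv, hρ_ker, inv_one, mul_one, mul_inv_cancel]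
      rw [h1, hadd _ _ (hρ_ker σ) h2, hconj (cs P) _ (by rw [map_inv, hρ_ker, inv_one]),
        hinv _ (hρ_ker σ), add_neg_cancel]
    -- compatibility of `φ (x y⁻¹)` with `φ`-equivalence (all elements over `q`)
    have hcompat : ∀ x x' y y' : hilbertClassField F ≃ₐ[B] hilbertClassField F,
        r x = q → r x' = q → r y = q → r y' = q →
        φ (x * x'⁻¹) = 0 → φ (y * y'⁻¹) = 0 → φ (x * y⁻¹) = φ (x' * y'⁻¹) := by
      intro x x' y y' hx hx' hy hy' hxx hyy
      have e1 : x * y⁻¹ = (x * x'⁻¹) * ((x' * y'⁻¹) * (y' * y⁻¹)) := by group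
      have r1 : r (x * x'⁻¹) = 1 := by rw [map_mul, map_inv, hx, hx', mul_inv_cancel]
      have r2 : r (x' * y'⁻¹) = 1 := by rw [map_mul, map_inv, hx', hy', mul_inv_cancel]
      have r3 : r (y' * y⁻¹) = 1 := by rw [map_mul, map_inv, hy', hy, mul_inv_cancel]
      have r23 : r ((x' * y'⁻¹) * (y' * y⁻¹)) = 1 := by rw [map_mul, r2, r3, one_mul]
      have hyy' : φ (y' * y⁻¹) = 0 := by
        have : y' * y⁻¹ = (y * y'⁻¹)⁻¹ := by group
        rw [this, hinv _ (by rw [map_mul, map_inv, hy, hy', mul_inv_cancel]), hyy, neg_zero]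
      rw [e1, hadd _ _ r1 r23, hadd _ _ r2 r3, hxx, hyy', zero_add, add_zero]
    -- the cocycle `u` and the orbit lemma
    let u : Ideal (𝓞 F) → Ideal (𝓞 F) → V := fun P P' => φ (cs P * (cs P')⁻¹)
    have hu0 : ∀ P ∈ S, ∀ P' ∈ S, u P P' = 0 := by
      obtain ⟨P₀, hP₀max, hP₀e, hP₀orb⟩ := horb
      have hP₀S : P₀ ∈ S := by rw [hS]; exact ⟨hP₀max, hP₀e⟩
      obtain ⟨O, hOdef⟩ : ∃ O : Finset (Ideal (𝓞 F)),
          O = (Set.finite_range fun σ : F ≃ₐ[k] F => σ • P₀).toFinset := ⟨_, rfl⟩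
      have hmemO : ∀ z, z ∈ O ↔ ∃ σ : F ≃ₐ[k] F, σ • P₀ = z := fun z => by
        rw [hOdef, Set.Finite.mem_toFinset, Set.mem_range]
      have hOS : ∀ z ∈ O, z ∈ S := fun z hz => by
        obtain ⟨σ, rfl⟩ := (hmemO z).mp hz; exact hSsmul σ P₀ hP₀S
      have hOstab : ∀ (g : F ≃ₐ[k] F), ∀ z ∈ O, g • z ∈ O := fun g z hz => by
        obtain ⟨σ, rfl⟩ := (hmemO z).mp hz
        exact (hmemO _).mpr ⟨g * σ, mul_smul g σ P₀⟩
      have hOcard : O.card.Coprime p := by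
        have hO' : (O : Set (Ideal (𝓞 F))) = MulAction.orbit (F ≃ₐ[k] F) P₀ := by
          ext z; simp only [Finset.mem_coe, hmemO, MulAction.mem_orbit_iff]
        have h1 : O.card = (MulAction.stabilizer (F ≃ₐ[k] F) P₀).index := by
          rw [MulAction.index_stabilizer, ← hO', Set.ncard_coe_finset]
        rw [h1]
        exact (Nat.Prime.coprime_iff_not_dvd hp.out).mpr hP₀orb |>.symm
      intro P hP P' hP'
      refine cocycle_eq_zero_of_coprime_card π hpV S O hOS hOstab hOcard u ?_ ?_ ?_ hP hP'
      · -- cocycle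
        intro x hx y hy z hz
        simp only [u]
        have ex : cs x * (cs z)⁻¹ = (cs x * (cs y)⁻¹) * (cs y * (cs z)⁻¹) := by group
        have r1 : r (cs x * (cs y)⁻¹) = 1 := by rw [map_mul, map_inv, (hc x hx).2.2.2, (hc y hy).2.2.2, mul_inv_cancel]
        have r2 : r (cs y * (cs z)⁻¹) = 1 := by rw [map_mul, map_inv, (hc y hy).2.2.2, (hc z hz).2.2.2, mul_inv_cancel]
        rw [ex, hadd _ _ r1 r2]
      · -- equivariance
        intro τ x hx y hy
        simp only [u]
        obtain ⟨g, hg⟩ := hrk_surj (π τ)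
        obtain ⟨hxQ, hxU, hxs, hxr⟩ := hc x hx
        obtain ⟨hyQ, hyU, hys, hyr⟩ := hc y hy
        haveI := hxQ; haveI := hyQ
        obtain ⟨s', hs'⟩ := exists_conj g (cs x)
        obtain ⟨t', ht'⟩ := exists_conj g (cs y)
        -- `s'` is an inertia element over `π τ • x` with image `q`; likewise `t'`
        have hs'I : s' ∈ (g • cQ x).inertia _ := conj_mem_inertia g hs' hxs
        have ht'I : t' ∈ (g • cQ y).inertia _ := conj_mem_inertia g ht' hys
        have hs'r : r s' = q := by rw [hr_conj g _ _ hs', hxr]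
        have ht'r : r t' = q := by rw [hr_conj g _ _ ht', hyr]
        haveI : (g • cQ x).IsMaximal := smul_isMaximal g (cQ x)
        haveI : (g • cQ y).IsMaximal := smul_isMaximal g (cQ y)
        have hxU' : (g • cQ x).under (𝓞 F) = π τ • x := by
          rw [under_smul, hxU, ← hrk_eq, hg]
        have hyU' : (g • cQ y).under (𝓞 F) = π τ • y := by
          rw [under_smul, hyU, ← hrk_eq, hg]
        have hxS' : π τ • x ∈ S := hSsmul _ x hx
        have hyS' : π τ • y ∈ S := hSsmul _ y hy
        have e1 : φ (s' * t'⁻¹) = φ (cs (π τ • x) * (cs (π τ • y))⁻¹) :=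
          hcompat s' (cs _) t' (cs _) hs'r (hc _ hxS').2.2.2 ht'r (hc _ hyS').2.2.2
            (hwd _ hxS' (g • cQ x) hxU' s' hs'I hs'r) (hwd _ hyS' (g • cQ y) hyU' t' ht'I ht'r)
        rw [← e1]
        have r1 : r (cs x * (cs y)⁻¹) = 1 := by rw [map_mul, map_inv, hxr, hyr, mul_inv_cancel]
        exact hφequiv τ g (cs x * (cs y)⁻¹) (s' * t'⁻¹) hg (conj_mul_inv g hs' ht') r1
      · -- fixed vectors
        intro x hx v hv
        rw [hS] at hx
        haveI := hx.1
        exact hD x hx.2 v hv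
    -- conclusion of (i)
    have hQS : Q.under (𝓞 F) ∈ S := by
      rw [hS]
      refine ⟨Ideal.IsMaximal.under (𝓞 F) Q, ?_⟩
      rw [← hcardI Q, ne_eq, Subgroup.card_eq_one]
      intro h; rw [h, Subgroup.mem_bot] at hs; exact hq1 (by rw [hs, map_one])
    have hQ'S : Q'.under (𝓞 F) ∈ S := by
      rw [hS]
      refine ⟨Ideal.IsMaximal.under (𝓞 F) Q', ?_⟩
      rw [← hcardI Q', ne_eq, Subgroup.card_eq_one]
      intro h; rw [h, Subgroup.mem_bot] at ht; apply hq1; rw [hst, ht, map_one]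
    rw [hcompat s (cs (Q.under (𝓞 F))) t (cs (Q'.under (𝓞 F))) hq (hc _ hQS).2.2.2 (hst.symm.trans hq)
      (hc _ hQ'S).2.2.2 (hwd _ hQS Q rfl s hs hq) (hwd _ hQ'S Q' rfl t ht (hst.symm.trans hq))]
    exact hu0 _ hQS _ hQ'S
  -- ### (ii) the extension `χ` of `φ` to `GB` through a homomorphic section of `r`
  obtain ⟨P₀, hP₀max, hP₀e, -⟩ := horb
  obtain ⟨Q₀, hQ₀max, hQ₀P⟩ := hexQ P₀ hP₀max
  haveI := hQ₀max
  have hsec : ∀ q : F ≃ₐ[B] F, ∃ s ∈ Q₀.inertia (hilbertClassField F ≃ₐ[B] hilbertClassField F), r s = q :=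
    hIsurj Q₀ (hQ₀P.symm ▸ hP₀e)
  choose sec hsecI hsecr using hsec
  have hsec_mul : ∀ q q', sec (q * q') = sec q * sec q' :=
    fun q q' => hIuniq Q₀ _ (hsecI _) _ (mul_mem (hsecI q) (hsecI q')) (by rw [hsecr, map_mul, hsecr, hsecr])
  have hsec_one : sec 1 = 1 := hI1 Q₀ _ (hsecI 1) (hsecr 1)
  let χ : (hilbertClassField F ≃ₐ[B] hilbertClassField F) → V := fun g => φ (g * (sec (r g))⁻¹)
  have hker : ∀ g, r (g * (sec (r g))⁻¹) = 1 := fun g => by rw [map_mul, map_inv, hsecr, mul_inv_cancel]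
  have hχadd : ∀ a b, χ (a * b) = χ a + χ b := by
    intro a b
    simp only [χ]
    have e1 : a * b * (sec (r (a * b)))⁻¹ =
        (a * (sec (r a))⁻¹) * (sec (r a) * (b * (sec (r b))⁻¹) * (sec (r a))⁻¹) := by
      rw [map_mul, hsec_mul]; group
    rw [e1, hadd _ _ (hker a) (by rw [map_mul, map_mul, hker b, mul_one, map_inv, mul_inv_cancel]),
      hconj _ _ (hker b)]
  have hχI : ∀ (Q : Ideal (𝓞 (hilbertClassField F))) [Q.IsMaximal],
      ∀ s ∈ Q.inertia (hilbertClassField F ≃ₐ[B] hilbertClassField F), χ s = 0 :=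
    fun Q _ s hs => hdiff Q Q₀ s hs (sec (r s)) (hsecI _) (hsecr _).symm
  have hχequiv : ∀ (τ : Γ) (g : hilbertClassField F ≃ₐ[k] hilbertClassField F)
      (a a' : hilbertClassField F ≃ₐ[B] hilbertClassField F),
      AlgEquiv.restrictNormalHom F g = π τ → (∀ y, a' y = g (a (g.symm y))) → χ a' = τ • χ a := by
    intro τ g a a' hg ha'
    rw [← hrk] at hg
    simp only [χ]
    obtain ⟨c', hc'⟩ := exists_conj g (sec (r a))
    have hc'I : c' ∈ (g • Q₀).inertia _ := conj_mem_inertia g hc' (hsecI _)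
    have hc'r : r c' = r a := by rw [hr_conj g _ _ hc', hsecr]
    have hra' : r a' = r a := hr_conj g a a' ha'
    haveI : (g • Q₀).IsMaximal := smul_isMaximal g Q₀
    -- `φ (c' sec(r a)⁻¹) = 0`, so `φ (a' sec⁻¹) = φ (a' c'⁻¹) = φ (conj (a sec⁻¹)) = τ • φ (a sec⁻¹)`
    have h1 : φ (c' * (sec (r a))⁻¹) = 0 := hdiff (g • Q₀) Q₀ c' hc'I (sec (r a)) (hsecI _) (by rw [hc'r, hsecr])
    have e1 : a' * (sec (r a'))⁻¹ = (a' * c'⁻¹) * (c' * (sec (r a))⁻¹) := by rw [hra']; group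
    have r1 : r (a' * c'⁻¹) = 1 := by rw [map_mul, map_inv, hra', hc'r, mul_inv_cancel]
    have r2 : r (c' * (sec (r a))⁻¹) = 1 := by rw [map_mul, map_inv, hc'r, hsecr, mul_inv_cancel]
    rw [e1, hadd _ _ r1 r2, h1, add_zero]
    exact hφequiv τ g (a * (sec (r a))⁻¹) (a' * c'⁻¹) hg (conj_mul_inv g ha' hc') (hker a)
  -- ### conclusion: `χ = 0` by (c2*), hence `φ = 0` on `ker r`, hence `f = 0`
  have hχ0 := h0 χ hχadd hχI hχequiv
  refine AddMonoidHom.ext fun c => ?_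
  obtain ⟨c, rfl⟩ := Additive.ofMul.surjective c
  have h1 : χ (ρ (artinEquiv F c)) = 0 := hχ0 _
  simp only [χ, hρ_ker, hsec_one, inv_one, mul_one] at h1
  rw [hφρ] at h1
  rw [AddMonoidHom.zero_apply]
  exact h1

end Main

end EquivariantIwasawaLemma

end Literature.NumberTheory.NumberFields

end
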